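import Summits.QuantumFields.BalabanUV.Beta.SecondOrderUnits
import Summits.QuantumFields.BalabanUV.Beta.MultiplierTableSlot
import Summits.QuantumFields.BalabanUV.Beta.WardLocusStencils
import Summits.QuantumFields.BalabanUV.Beta.GAN24.CombesThomas

/-!
# `BalabanUV.Beta.FP.PerfectAveragingTables` — road «FP» for binder row D1, owner row **N1-J∞-W** (d1-p3 g12 ROWS OPEN, `LEAVES-FP.md`), FILE 1∕2:
# THE UNIT-RESCALED WEIGHTED AVERAGING TABLES OF THE LITERAL'S SECOND-ORDER SLOT ARE `j`-INDEPENDENT ON THE ff BLOCK — THE TABLE LIMITS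
# `M∞`, `M₂∞` (m = 1) AND THEIR ROWS IN THE CURRENCIES OF `ResponseVertexLimit` ∕ `MixVertexLimit`

HONEST DEPENDENCY (page 1, mandatory): continuum YM on T⁴ ⇐ BetaPertH ∧ nine spine estimates (0/9 proved); BetaPertH ⇐ (D1) ∧ (D4) ∧ CAP+tail;
G-an2-4 gates asym, D1 and NE2/3/4.  HONEST FRAMING (cell contract, verbatim): «discharging `BetaPertH` makes Bałaban's UV stability UNCONDITIONAL —
a real constructive-QFT result; it is NOT the continuum limit and NOT the Clay problem.»  THIS MODULE is [folklore] bookkeeping (powers of `Lc^j`,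
blockwise, on the tree's typed unit maps and weighted tables; no `def`, no `def … : Prop`, nothing cited, 0 sorry).  0∕4 row-D1 binders; discharges
NO (CONV-C) row and NO table letter; NOT N2, NOT SDF, NOT D1, NOT BetaPertH, NOT continuum, NOT Clay.  «not in print; our bookkeeping».

ABSOLUTE RULE (cell charter, verbatim): «No internally-minted statement may enter as a cited fact. Every hypothesis is either kernel-proved in this package or a
verbatim quotation of a PUBLISHED theorem with page reference. The manuscript(s) under audit are NOT citable for their own disputed steps — they are the thing
under adjudication; programme-internal (2001/route/tribunal) claims are never citable.»

WHY (owner d1-p3 g12, `JETS-JM-DESIGN.md` v2 §4 (d), row N1-J∞-W): under R-FP-41 the literal's second-order slot at step `j` is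
`WsymOf … j = W2SymOfK (Gsym j) Lc (SpureSymOf j) (tabs.M j) (T2RecOf … j) (M2Of 3 Lc tabs.mixFF j)` (an2), and in leg units (`SecondOrderUnits.unitW_W2SymOfK`)
`unitW_j (WsymOf j) = W2SymOfK (unitK_j (Gsym j)) Lc (unitS_j (SpureSymOf j)) (unitM_j (tabs.M j)) (unitS₂_j (T2RecOf j)) (unitM₂_j (M2Of 3 Lc tabs.mixFF j))`.
The fixed-point equation `W∞ = W2SymOfK G∞ Lc S♭∞ M∞ S₂∞ M₂∞` (FILE 2 `PerfectTableFixedPoint`) therefore needs, slot by slot, uniform rows and geometric rates of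
the unit-rescaled data; the two TABLE slots are what this file supplies («what is new: the TABLE limits `M∞`, `M₂∞` of `tabs.M j`, `M2Of tabs.mixFF j` in units,
m = 1 ONLY» — owner).  THE LOCATED ANSWER to the owner's «are the rescaled weights `j`-independent?»: with `s := Lc^j`, `(s_f, s_m) = (sfStep Lc j, smStep d Lc j)
= (s, s^{d+1})` and the weights `wM1 j = s^{2(d+2)}`, `wM2 j = s^{3(d+2)}` of `BalabanStepW2`, the unit map `unitM` (resp. `unitM₂`) multiplies the weighted table by
`s²` and conjugates by `D⁻¹ = diag(s⁻¹ ∣ s^{−(d+1)})`, so the net factor is **`1` on the (inl,inl) block, `s^{−d}` on the (inl,inr)∕(inr,inl) blocks, `s^{−2d}` on the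
(inr,inr) block** (§1): for ff-SUPPORTED tables (block-shape letters (ShH)∕(Shmix) below — TRUE for an1's values, `hessFF`-type `H` and the fluctuation–fluctuation
`mixFF`, but NOT fields of `SymTables`, exactly leaf-06's caveat (ShV)(ShH) for the S-side) the unit-rescaled weighted tables are **`j`-INDEPENDENT** (§2), the
table limits are the tables themselves and the rate is ZERO (§3).  No finding against the literal's normalisation; the m = 1 tables need NO composite averaging
(R-FP-41′ stays parked for m ≥ 2).

CONTENT ([folklore]; generic `d`, `[NeZero Lc]`).
* §1 `smStep_eq_pow`; the BLOCKWISE ENTRIES of `unitM (sfStep Lc j) (smStep d Lc j) (M1Of d Lc H cΛ j)` — `unitM_M1Of_inl_inl` (factor `1`),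
  `unitM_M1Of_inl_inr`∕`_inr_inl` (factor `(s^d)⁻¹`), `unitM_M1Of_inr_inr` (factor `(s^{2d})⁻¹`) — and of `unitM₂ (sfStep Lc j) (smStep d Lc j) (M2Of d Lc mixFF j)`
  (`unitM₂_M2Of_inl_inl` ∕ `_inl_inr` ∕ `_inr_inl` ∕ `_inr_inr`, same factors).
* §2 **`unitM_M1Of_of_ff`**: `(∀ μ w, ffK (H μ w) = H μ w) → unitM (sfStep Lc j) (smStep d Lc j) (M1Of d Lc H cΛ j) = fun μ w => cΛ • H μ w` (every `j`);
  **`unitM₂_M2Of_of_ff`**: `(∀ κ u ρ w, ffK (mixFF κ u ρ w) = mixFF κ u ρ w) → unitM₂ (sfStep Lc j) (smStep d Lc j) (M2Of d Lc mixFF j) = mixFF`.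
* §3 THE ROWS, in EXACTLY the currencies of `ResponseVertexLimit.limTabOf_resp_eq` (M-slot: `VertexFamily _ Lc CM m`, rate `VertexFamily (M̃_j − M∞) Lc (cM·θ^j) m`)
  and `MixVertexLimit.limTabOf_mixOfK_eq` (M₂-slot: `LocStencilFM Lc _ C₂ m`, rate `LocStencilFM Lc (M̃₂,j − M₂∞) Lc (c₂·θ^j) m`) with `M∞ := fun μ w => cΛ • H μ w`,
  `M₂∞ := mixFF` and `cM = c₂ = 0`: `vertexFamily_unitM_M1Of_of_ff`, `vertexFamily_Minf_of_loc`, `vertexFamily_unitM_M1Of_sub_of_ff`, `locStencilFM_unitM₂_M2Of_of_ff`,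
  `locStencilFM_unitM₂_M2Of_sub_of_ff` (from ONE uniform letter `VertexFamily H Lc CH m` ∕ `LocStencilFM Lc mixFF C₂ m` of the LEVEL-FREE tables — the
  `SymTables` letters `hH` (every rate) ∕ `hmix`).
NOT HERE: the general (non-ff-supported) tables — they converge to the ff-parts `cΛ • ffK∘H`, `ffK∘mixFF` at ratio `(Lc^d)⁻¹` (§1 gives the exact deviation entries;
the class∕rate packaging is left to the day a non-ff table is typed); the m-fold (m ≥ 2) perfect averaging tables (R-FP-41′, `ScaleNesting.avgLift_avgLift`) —
FILE 3 of the row; any identification with Bałaban's objects.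
Provenance: D1 formalisation swarm LEAF PROVER 02, unit b2b-balaban-beta-d1-formalise-leaf-02 gen 12, 2026-08-21 (MINE journal «N1-J∞-W», INTENT 2).  No existing
file touched.
-/

noncomputable section

namespace Summit.QuantumFields.BalabanUV.Beta.FP.PerfectAveragingTables

open Literature.MathematicalPhysics.QuantumFieldTheory.Balaban1983to89
open Literature.MathematicalPhysics.QuantumFieldTheory.Balaban1983to89.Beta
open ExpKernelCalculus (MKer BiLoc VertexFamily)
open OneStepResolventKernel (Fib)
open BalabanStepW2 (M2Of wM1 wM2)
open SecondOrderResponse (LocStencilFM biLoc_smul)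
open HessKerRate (biLoc_zero)
open Summit.QuantumFields.BalabanUV.Beta.HessKerDressedUnits (legScale legScale_inl legScale_inr counitK counitK_apply)
open Summit.QuantumFields.BalabanUV.Beta.SecondOrderUnits (unitM unitM₂ unitM_apply)
open Summit.QuantumFields.BalabanUV.Beta.SpineRooted (M1Of M1Of_apply)
open Summit.QuantumFields.BalabanUV.Beta.WardLocusStencils (ffK ffK_inl_inl ffK_inl_inr ffK_inr_inl ffK_inr_inr)
open Summit.QuantumFields.BalabanUV.Beta.GAN24.CombesThomas (sfStep smStep)

variable {d : ℕ} {Lc : ℕ} [NeZero Lc]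

/-! ## §1 The step units as powers of `s := Lc^j`; blockwise entries of the unit-rescaled weighted tables -/

omit [NeZero Lc] in
/-- [folklore] `smStep d Lc j = (Lc^j)^{d+1}`. -/
theorem smStep_eq_pow (j : ℕ) : smStep d Lc j = ((Lc : ℝ) ^ j) ^ (d + 1) := by
  unfold smStep; rw [pow_mul]

omit [NeZero Lc] in
/-- [folklore] `sfStep Lc j = Lc^j` (`rfl`). -/
theorem sfStep_eq_pow (j : ℕ) : sfStep Lc j = (Lc : ℝ) ^ j := rfl

/-- [folklore] `Lc^j ≠ 0`. -/
private theorem pow_step_ne_zero (j : ℕ) : ((Lc : ℝ) ^ j) ≠ 0 := pow_ne_zero _ (Nat.cast_ne_zero.2 (NeZero.ne Lc))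

section Entries

variable (H : Fin (d + 1) → (Fin (d + 1) → ℤ) → MKer (d + 1) (Fib d))
  (mixFF : Fin (d + 1) → (Fin (d + 1) → ℤ) → Fin (d + 1) → (Fin (d + 1) → ℤ) → MKer (d + 1) (Fib d)) (cΛ : ℝ) (j : ℕ)

/-- [folklore] **ff BLOCK, FACTOR ONE**: `unitM_j (M1Of H cΛ j)` on `(inl α, inl β)` is `cΛ · H` — `s²·s⁻¹·s⁻¹ = 1`, NO power of `Lc^j` left. -/
theorem unitM_M1Of_inl_inl (ρ : Fin (d + 1)) (w x z : Fin (d + 1) → ℤ) (α β : Fin (d + 1)) :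
    unitM (sfStep Lc j) (smStep d Lc j) (M1Of d Lc H cΛ j) ρ w x z (Sum.inl α) (Sum.inl β) = cΛ * H ρ w x z (Sum.inl α) (Sum.inl β) := by
  have hs := pow_step_ne_zero (Lc := Lc) j
  simp only [unitM_apply, M1Of_apply, Pi.smul_apply, smul_eq_mul, legScale_inl, sfStep_eq_pow, smStep_eq_pow, wM1]
  field_simp
  ring

/-- [folklore] **fm BLOCK, FACTOR `(s^d)⁻¹`**. -/
theorem unitM_M1Of_inl_inr (ρ : Fin (d + 1)) (w x z : Fin (d + 1) → ℤ) (α m : Fin (d + 1)) :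
    unitM (sfStep Lc j) (smStep d Lc j) (M1Of d Lc H cΛ j) ρ w x z (Sum.inl α) (Sum.inr m) =
      cΛ * ((((Lc : ℝ) ^ j) ^ d)⁻¹ * H ρ w x z (Sum.inl α) (Sum.inr m)) := by
  have hs := pow_step_ne_zero (Lc := Lc) j
  simp only [unitM_apply, M1Of_apply, Pi.smul_apply, smul_eq_mul, legScale_inl, legScale_inr, sfStep_eq_pow, smStep_eq_pow, wM1]
  field_simp
  ring

/-- [folklore] **mf BLOCK, FACTOR `(s^d)⁻¹`**. -/
theorem unitM_M1Of_inr_inl (ρ : Fin (d + 1)) (w x z : Fin (d + 1) → ℤ) (m β : Fin (d + 1)) :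
    unitM (sfStep Lc j) (smStep d Lc j) (M1Of d Lc H cΛ j) ρ w x z (Sum.inr m) (Sum.inl β) =
      cΛ * ((((Lc : ℝ) ^ j) ^ d)⁻¹ * H ρ w x z (Sum.inr m) (Sum.inl β)) := by
  have hs := pow_step_ne_zero (Lc := Lc) j
  simp only [unitM_apply, M1Of_apply, Pi.smul_apply, smul_eq_mul, legScale_inl, legScale_inr, sfStep_eq_pow, smStep_eq_pow, wM1]
  field_simp
  ring

/-- [folklore] **mm BLOCK, FACTOR `(s^{2d})⁻¹`**. -/
theorem unitM_M1Of_inr_inr (ρ : Fin (d + 1)) (w x z : Fin (d + 1) → ℤ) (m m' : Fin (d + 1)) :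
    unitM (sfStep Lc j) (smStep d Lc j) (M1Of d Lc H cΛ j) ρ w x z (Sum.inr m) (Sum.inr m') =
      cΛ * ((((Lc : ℝ) ^ j) ^ (2 * d))⁻¹ * H ρ w x z (Sum.inr m) (Sum.inr m')) := by
  have hs := pow_step_ne_zero (Lc := Lc) j
  simp only [unitM_apply, M1Of_apply, Pi.smul_apply, smul_eq_mul, legScale_inr, sfStep_eq_pow, smStep_eq_pow, wM1]
  field_simp
  ring

omit [NeZero Lc] in
/-- [folklore] Entries of the unit-rescaled weighted mixed table: `unitM₂ s_f s_m (M2Of mixFF j) κ u ρ w x z a b = (s_f s_m)⁻¹·(s_m²)⁻¹·D⁻¹_a·(wM2 j·mixFF…)·D⁻¹_b`. -/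
theorem unitM₂_M2Of_apply (sf sm : ℝ) (κ : Fin (d + 1)) (u : Fin (d + 1) → ℤ) (ρ : Fin (d + 1)) (w x z : Fin (d + 1) → ℤ) (a b : Fib d) :
    unitM₂ sf sm (M2Of d Lc mixFF j) κ u ρ w x z a b =
      (sf * sm)⁻¹ * ((sm * sm)⁻¹ * (legScale sf⁻¹ sm⁻¹ a * (wM2 d Lc j * mixFF κ u ρ w x z a b) * legScale sf⁻¹ sm⁻¹ b)) := by
  simp only [unitM₂, M2Of, unitM_apply, Pi.smul_apply, smul_eq_mul]

/-- [folklore] **ff BLOCK, FACTOR ONE** for the mixed table: `unitM₂_j (M2Of mixFF j)` on `(inl α, inl β)` is `mixFF` — `s^{3(d+2)}·s^{−(d+2)}·s^{−2(d+1)}·s⁻² = 1`. -/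
theorem unitM₂_M2Of_inl_inl (κ : Fin (d + 1)) (u : Fin (d + 1) → ℤ) (ρ : Fin (d + 1)) (w x z : Fin (d + 1) → ℤ) (α β : Fin (d + 1)) :
    unitM₂ (sfStep Lc j) (smStep d Lc j) (M2Of d Lc mixFF j) κ u ρ w x z (Sum.inl α) (Sum.inl β) = mixFF κ u ρ w x z (Sum.inl α) (Sum.inl β) := by
  have hs := pow_step_ne_zero (Lc := Lc) j
  rw [unitM₂_M2Of_apply]
  simp only [legScale_inl, sfStep_eq_pow, smStep_eq_pow, wM2]
  field_simp
  ring

/-- [folklore] **fm BLOCK, FACTOR `(s^d)⁻¹`** for the mixed table. -/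
theorem unitM₂_M2Of_inl_inr (κ : Fin (d + 1)) (u : Fin (d + 1) → ℤ) (ρ : Fin (d + 1)) (w x z : Fin (d + 1) → ℤ) (α m : Fin (d + 1)) :
    unitM₂ (sfStep Lc j) (smStep d Lc j) (M2Of d Lc mixFF j) κ u ρ w x z (Sum.inl α) (Sum.inr m) =
      (((Lc : ℝ) ^ j) ^ d)⁻¹ * mixFF κ u ρ w x z (Sum.inl α) (Sum.inr m) := by
  have hs := pow_step_ne_zero (Lc := Lc) j
  rw [unitM₂_M2Of_apply]
  simp only [legScale_inl, legScale_inr, sfStep_eq_pow, smStep_eq_pow, wM2]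
  field_simp
  ring

/-- [folklore] **mf BLOCK, FACTOR `(s^d)⁻¹`** for the mixed table. -/
theorem unitM₂_M2Of_inr_inl (κ : Fin (d + 1)) (u : Fin (d + 1) → ℤ) (ρ : Fin (d + 1)) (w x z : Fin (d + 1) → ℤ) (m β : Fin (d + 1)) :
    unitM₂ (sfStep Lc j) (smStep d Lc j) (M2Of d Lc mixFF j) κ u ρ w x z (Sum.inr m) (Sum.inl β) =
      (((Lc : ℝ) ^ j) ^ d)⁻¹ * mixFF κ u ρ w x z (Sum.inr m) (Sum.inl β) := by
  have hs := pow_step_ne_zero (Lc := Lc) j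
  rw [unitM₂_M2Of_apply]
  simp only [legScale_inl, legScale_inr, sfStep_eq_pow, smStep_eq_pow, wM2]
  field_simp
  ring

/-- [folklore] **mm BLOCK, FACTOR `(s^{2d})⁻¹`** for the mixed table. -/
theorem unitM₂_M2Of_inr_inr (κ : Fin (d + 1)) (u : Fin (d + 1) → ℤ) (ρ : Fin (d + 1)) (w x z : Fin (d + 1) → ℤ) (m m' : Fin (d + 1)) :
    unitM₂ (sfStep Lc j) (smStep d Lc j) (M2Of d Lc mixFF j) κ u ρ w x z (Sum.inr m) (Sum.inr m') =
      (((Lc : ℝ) ^ j) ^ (2 * d))⁻¹ * mixFF κ u ρ w x z (Sum.inr m) (Sum.inr m') := by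
  have hs := pow_step_ne_zero (Lc := Lc) j
  rw [unitM₂_M2Of_apply]
  simp only [legScale_inr, sfStep_eq_pow, smStep_eq_pow, wM2]
  field_simp
  ring

end Entries

/-! ## §2 ff-supported tables: the unit-rescaled weighted tables are `j`-INDEPENDENT -/

section FF

variable {H : Fin (d + 1) → (Fin (d + 1) → ℤ) → MKer (d + 1) (Fib d)}
  {mixFF : Fin (d + 1) → (Fin (d + 1) → ℤ) → Fin (d + 1) → (Fin (d + 1) → ℤ) → MKer (d + 1) (Fib d)}

/-- [folklore] **(ShH) ⟹ `unitM_j (M1Of H cΛ j) = cΛ • H` FOR EVERY `j`** — the unit-rescaled weighted multiplier table of an ff-supported constraint-Hessian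
table does not depend on the level: ITS LIMIT IS ITSELF.  (ShH): `ffK (H μ w) = H μ w` (the table vanishes off the (inl,inl) block — an1's `hessFF`-type values). -/
theorem unitM_M1Of_of_ff (hH : ∀ μ w, ffK (H μ w) = H μ w) (cΛ : ℝ) (j : ℕ) :
    unitM (sfStep Lc j) (smStep d Lc j) (M1Of d Lc H cΛ j) = fun μ w => cΛ • H μ w := by
  funext ρ w x z a b
  rcases a with α | m <;> rcases b with β | m'
  · rw [unitM_M1Of_inl_inl]; simp only [Pi.smul_apply, smul_eq_mul]
  · have h0 : H ρ w x z (Sum.inl α) (Sum.inr m') = 0 := by rw [← hH ρ w, ffK_inl_inr]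
    rw [unitM_M1Of_inl_inr]; simp only [Pi.smul_apply, smul_eq_mul, h0, mul_zero]
  · have h0 : H ρ w x z (Sum.inr m) (Sum.inl β) = 0 := by rw [← hH ρ w, ffK_inr_inl]
    rw [unitM_M1Of_inr_inl]; simp only [Pi.smul_apply, smul_eq_mul, h0, mul_zero]
  · have h0 : H ρ w x z (Sum.inr m) (Sum.inr m') = 0 := by rw [← hH ρ w, ffK_inr_inr]
    rw [unitM_M1Of_inr_inr]; simp only [Pi.smul_apply, smul_eq_mul, h0, mul_zero]

/-- [folklore] **(Shmix) ⟹ `unitM₂_j (M2Of mixFF j) = mixFF` FOR EVERY `j`** — the unit-rescaled weighted mixed table of an ff-supported field–multiplier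
table does not depend on the level.  (Shmix): `ffK (mixFF κ u ρ w) = mixFF κ u ρ w`. -/
theorem unitM₂_M2Of_of_ff (hmix : ∀ κ u ρ w, ffK (mixFF κ u ρ w) = mixFF κ u ρ w) (j : ℕ) :
    unitM₂ (sfStep Lc j) (smStep d Lc j) (M2Of d Lc mixFF j) = mixFF := by
  funext κ u ρ w x z a b
  rcases a with α | m <;> rcases b with β | m'
  · exact unitM₂_M2Of_inl_inl mixFF j κ u ρ w x z α β
  · have h0 : mixFF κ u ρ w x z (Sum.inl α) (Sum.inr m') = 0 := by rw [← hmix κ u ρ w, ffK_inl_inr]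
    rw [unitM₂_M2Of_inl_inr, h0, mul_zero]
  · have h0 : mixFF κ u ρ w x z (Sum.inr m) (Sum.inl β) = 0 := by rw [← hmix κ u ρ w, ffK_inr_inl]
    rw [unitM₂_M2Of_inr_inl, h0, mul_zero]
  · have h0 : mixFF κ u ρ w x z (Sum.inr m) (Sum.inr m') = 0 := by rw [← hmix κ u ρ w, ffK_inr_inr]
    rw [unitM₂_M2Of_inr_inr, h0, mul_zero]

end FF

/-! ## §3 The rows of the two table slots, in the currencies of `ResponseVertexLimit` ∕ `MixVertexLimit` (rate ZERO) -/

section Rows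

variable {H : Fin (d + 1) → (Fin (d + 1) → ℤ) → MKer (d + 1) (Fib d)}
  {mixFF : Fin (d + 1) → (Fin (d + 1) → ℤ) → Fin (d + 1) → (Fin (d + 1) → ℤ) → MKer (d + 1) (Fib d)}

/-- [folklore] **M-SLOT, UNIFORM ROW** under (ShH): `VertexFamily (unitM_j (M1Of H cΛ j)) Lc (|cΛ|·CH) m` for EVERY `j`, from ONE letter `VertexFamily H Lc CH m` of the
level-free table (the `SymTables.hH` letter at rate `m`) — the `hM` hypothesis shape of `ResponseVertexLimit.limTabOf_resp_eq`. -/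
theorem vertexFamily_unitM_M1Of_of_ff (hH : ∀ μ w, ffK (H μ w) = H μ w) {CH m : ℝ} (hHloc : VertexFamily H Lc CH m) (cΛ : ℝ) :
    ∀ j : ℕ, VertexFamily (unitM (sfStep Lc j) (smStep d Lc j) (M1Of d Lc H cΛ j)) Lc (|cΛ| * CH) m := fun j => by
  rw [unitM_M1Of_of_ff hH]
  exact fun μ w => biLoc_smul cΛ (hHloc μ w)

omit [NeZero Lc] in
/-- [folklore] **M-SLOT, THE LIMIT ROW**: `M∞ := fun μ w => cΛ • H μ w` IS a vertex family with the same constant (the `hMinf` shape). -/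
theorem vertexFamily_Minf_of_loc {CH m : ℝ} (hHloc : VertexFamily H Lc CH m) (cΛ : ℝ) :
    VertexFamily (fun μ w => cΛ • H μ w) Lc (|cΛ| * CH) m :=
  fun μ w => biLoc_smul cΛ (hHloc μ w)

/-- [folklore] **M-SLOT, RATE ROW (ZERO)** under (ShH): `VertexFamily (unitM_j (M1Of H cΛ j) − M∞) Lc (0·θ^j) m` for EVERY `j` and EVERY ratio `θ` — the `hMrate` shape of
`ResponseVertexLimit.limTabOf_resp_eq` with `cM := 0`. -/
theorem vertexFamily_unitM_M1Of_sub_of_ff (hH : ∀ μ w, ffK (H μ w) = H μ w) (cΛ m θ : ℝ) :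
    ∀ j : ℕ, VertexFamily (unitM (sfStep Lc j) (smStep d Lc j) (M1Of d Lc H cΛ j) - fun μ w => cΛ • H μ w) Lc (0 * θ ^ j) m := fun j => by
  rw [unitM_M1Of_of_ff hH, sub_self, zero_mul]
  exact fun μ w => biLoc_zero _ _ _

/-- [folklore] **M₂-SLOT, UNIFORM ROW** under (Shmix): `LocStencilFM Lc (unitM₂_j (M2Of mixFF j)) C₂ m` for EVERY `j`, from ONE letter `LocStencilFM Lc mixFF C₂ m` (the
`SymTables.hmix` letter) — the `hM` hypothesis shape of `MixVertexLimit.limTabOf_mixOfK_eq`. -/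
theorem locStencilFM_unitM₂_M2Of_of_ff (hmix : ∀ κ u ρ w, ffK (mixFF κ u ρ w) = mixFF κ u ρ w) {C₂ m : ℝ} (hloc : LocStencilFM Lc mixFF C₂ m) :
    ∀ j : ℕ, LocStencilFM Lc (unitM₂ (sfStep Lc j) (smStep d Lc j) (M2Of d Lc mixFF j)) C₂ m := fun j => by
  rw [unitM₂_M2Of_of_ff hmix]
  exact hloc

/-- [folklore] **M₂-SLOT, RATE ROW (ZERO)** under (Shmix): `LocStencilFM Lc (unitM₂_j (M2Of mixFF j) − mixFF) (0·θ^j) m` for EVERY `j`, EVERY `θ` — the `hMrate` shape of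
`MixVertexLimit.limTabOf_mixOfK_eq` with `c₂ := 0`, `M₂∞ := mixFF`. -/
theorem locStencilFM_unitM₂_M2Of_sub_of_ff (hmix : ∀ κ u ρ w, ffK (mixFF κ u ρ w) = mixFF κ u ρ w) (m θ : ℝ) :
    ∀ j : ℕ, LocStencilFM Lc (unitM₂ (sfStep Lc j) (smStep d Lc j) (M2Of d Lc mixFF j) - mixFF) (0 * θ ^ j) m := fun j => by
  rw [unitM₂_M2Of_of_ff hmix, sub_self, zero_mul]
  intro κ u ρ w
  rw [zero_mul]
  exact biLoc_zero _ _ _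

end Rows

end Summit.QuantumFields.BalabanUV.Beta.FP.PerfectAveragingTables

end
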